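/-
Origin: expansion seat `planner-pub-hodgecm-pv06-g2-0`, handover (d) v3 2026-08-18T05:39:45Z (doc-only) (`HOME/pub-hodgecm-pv06-g2/lean/Pv06g2/TorusRealApprox.lean`, md5 a6e18db8, 82 lines);
landed by the gen-6 packager in gate run 23 REPLACES the earlier landed copy of `HodgeCM/PerL34/TorusRealApprox.lean` (import ^import Pv06g2\.Mirror\.→import HodgeCM.Literature. ×1; import ^import Pv[0-9]+g[0-9]+\.→import HodgeCM.PerL34. ×1).
-/
/-
Origin: HOME/pub-hodgecm-pv06-g2/lean/Pv06g2/TorusRealApprox.lean — session planner-pub-hodgecm-pv06-g2-0 (unit pub-hodgecm-pv06-g2,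
DAG-NODE PROVER #06 of 15, generation 2).  Intended final place: `HodgeCM/PerL34/TorusRealApprox.lean`
(namespace `HodgeCM.PerL34.DenseOrbit`).  WIP imports to rewrite at intake:
`Pv06g2.Mirror.RealApproximation` (byte-identical mirror of cf-hasseminkowski-g4's `CfHM4/RealApproximation.lean` v2,
md5 bfc0e30be33e, used ONLY to type-check this file) ↦ `HodgeCM.Literature.RealApproximation`;
`Pv06g2.DenseOrbit` ↦ `HodgeCM.PerL34.DenseOrbit`.  Closed, nothing cited beyond what the imported files cite, nothing posited.

# Torus real approximation (`U(1)_{L/L₀}`) in the `DenseRange` shape — NOT the N23c input (erratum adv1g6-O6)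

cf-HM4's PROVED fact `HodgeCM.Literature.RealApproximation_U1_holds` says: every `z ∈ ∏_{w ∣ ∞} ℂ` with `‖z_w‖ = 1`
lies in the closure of the image of `U(1)(L₀) = {a ∈ L : a ā = 1}` under `a ↦ (w(a))_w`.  Read in the closed subset
`∏_w U(1)` this is density of the corestricted map (`DenseOrbit.denseRange_codRestrict_iff`).  SCOPE: this is real
approximation for the one-dimensional TORI `U(W_i) ≅ U(1)_{L/L₀}` (the factors of PerL's `T = U(W₁) × U(W₂)`, `T′`,
tex l. 314–315), kept as a correct and possibly useful lemma.  It is NOT the real-approximation input of PerL Prop. 3.6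
Step 2 (ll. 430–433, node N23c): there `U(W)` is the unitary group of the hermitian PLANE `W` (tex l. 314, 384), whose
archimedean factors are `U(2)`/`U(1,1)`; that input is the kernel theorem `HodgeCM.Literature.RealApproximation_UH_holds`
(`HodgeCM/Literature/RealApproximationUnitary.lean`), consumed by `HodgeCM/PerL34/AnnihilationDense.lean`.  An earlier
header of this file (run 22) said "`U(W) = U(1)_{L/L₀}` … exactly the hypothesis `hRA`" — withdrawn (adversarial reader 1,
gen 6, objection O6).  Code unchanged.
-/
import Summits.HodgeConjecture.HodgeCM.Literature.RealApproximation_3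
import Summits.HodgeConjecture.HodgeCM.PerL34.DenseOrbit

/-! PORT of `HodgeCM/PerL34/TorusRealApprox.lean` (HodgeCMPerL run 82) — verbatim mechanical port; provenance in the PORT header line. -/

set_option autoImplicit false

noncomputable section

namespace HodgeCM
namespace PerL34
namespace DenseOrbit

open HodgeCM.Literature HodgeCM.Literature.RealApproximation NumberField Set

/-- `U(W)(L₀ ⊗ ℝ) = ∏_{w ∣ ∞} U(1)` as a (closed) subset of `∏_{w : InfinitePlace L} ℂ`. -/
def unitTorus (L : CMField) : Set (InfinitePlace L → ℂ) := {z | ∀ w, ‖z w‖ = 1}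

/-- (Ported verbatim from the HodgeCMPerL package; no docstring in the source.) -/
theorem isClosed_unitTorus (L : CMField) : IsClosed (unitTorus L) := by
  have : unitTorus L = ⋂ w : InfinitePlace L, {z : InfinitePlace L → ℂ | ‖z w‖ = 1} := by
    ext z; simp [unitTorus]
  rw [this]
  exact isClosed_iInter fun w => isClosed_eq ((continuous_apply w).norm) continuous_const

/-- (Ported verbatim from the HodgeCMPerL package; no docstring in the source.) -/
theorem torusEmb_mem_unitTorus (L : CMField) (a : normOne L) : torusEmb L a ∈ unitTorus L :=
  fun w => norm_torusEmb L a w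

/-- **Real approximation for the torus `U(W) = U(1)_{L/L₀}`, `DenseRange` form:** the archimedean embedding
`U(W)(L₀) → U(W)(L₀ ⊗ ℝ) = ∏_{w ∣ ∞} U(1)` has dense range.  (= cf-HM4 `RealApproximation_U1_holds` read through
`denseRange_codRestrict_iff`.) -/
theorem denseRange_torusEmb_unitTorus (L : CMField) :
    DenseRange ((unitTorus L).codRestrict (torusEmb L) (torusEmb_mem_unitTorus L)) :=
  (denseRange_codRestrict_iff _ _).mpr fun z hz => RealApproximation_U1_holds L z hz

/-- The same subset as the unitary group of the commutative C⋆-algebra `∏_w ℂ` (a topological group under the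
subspace topology — the natural `Ginf` for `DenseOrbit.dense_of_denseRange_fst`). -/
theorem mem_unitary_pi_iff (L : CMField) (z : InfinitePlace L → ℂ) :
    z ∈ unitary (InfinitePlace L → ℂ) ↔ ∀ w, ‖z w‖ = 1 := by
  rw [Unitary.mem_iff_star_mul_self, funext_iff]
  refine forall_congr' fun w => ?_
  simp only [Pi.mul_apply, Pi.star_apply, Pi.one_apply, Complex.star_def, Complex.conj_mul']
  constructor
  · intro h
    have h' : ‖z w‖ ^ 2 = 1 := by exact_mod_cast h
    exact (pow_eq_one_iff_of_nonneg (norm_nonneg _) two_ne_zero).mp h'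
  · intro h
    simp [h]

/-- (Ported verbatim from the HodgeCMPerL package; no docstring in the source.) -/
theorem torusEmb_mem_unitary (L : CMField) (a : normOne L) : torusEmb L a ∈ unitary (InfinitePlace L → ℂ) :=
  (mem_unitary_pi_iff L _).mpr (norm_torusEmb L a)

/-- Real approximation for `U(W) = U(1)_{L/L₀}` as density in the unitary GROUP `unitary (∏_w ℂ)`. -/
theorem denseRange_torusEmb_unitary (L : CMField) :
    DenseRange ((unitary (InfinitePlace L → ℂ) : Set (InfinitePlace L → ℂ)).codRestrict (torusEmb L)
      (torusEmb_mem_unitary L)) :=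
  (denseRange_codRestrict_iff _ _).mpr fun z hz =>
    RealApproximation_U1_holds L z ((mem_unitary_pi_iff L z).mp hz)

end DenseOrbit
end PerL34
end HodgeCM

end
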